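import Summits.BirchSwinnertonDyer.Rank1Residual.ManinAdditive.ThetaBrandtDegreeLaws
import Literature.NumberTheory.EllipticCurves.QuadraticTwist
import HarnessLib
import HarnessLib.Audit.Tags

/-!
# Twist descent at `16 ∥ N`: the `χ₋₄`-twist exponent law and degree law (cell bsd-f2-manin, desc g19 EXTRA, MEMO-desc §44)

TYPER NOTE (typer g19, T-desc-37).  SOURCE = HOME/desc/g19/Sketch-desc-g19x.lean sha16 429a761c250a8566 (241 l.; desc: farm rc 0 · 0 err · 0 warn ·
0 s∗rry, 5.9 s, check-g19x5.json; BC7 ProbeG19x/x2/x3 5/5 CLEAN), §1–§4 VERBATIM except: this note; five one-line docstrings; E-desc-137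
`TwistDescentExponentLaw` is a PLAIN `def … : Prop` (not `@[conjecture]`): desc files it as IN PRINT ([BarriosEtAl2025, Thm 5.1]) and partly a
tree theorem (`Literature…BarriosEtAl2025.conductorExponent_quadraticTwist_two_of_le_one`, `…Theorems.ManinLocalTwoThree.conductorExponent_eq_of_…
_dyadicTwist_le_one`) — a typed dictionary row awaiting a `_holds`, nothing asserted; the two arXiv locators (2411.08321 §4 p. 10, 2102.04185) are
carried as plain text, not `[cite:]` keys (no bib entry).  `@[conjecture]` on the cell's LAWS E-desc-136 `TwistDescentDegreeLawAtSixteen`, E-desc-138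
`QuadTwistDegreeInvariance`, E-desc-139 `QuadTwistDegreeInvarianceAt p` / `QuadTwistDegreeInvarianceAllPrimes`.  Imports = desc's (landed leaf
`ThetaBrandtDegreeLaws` + `Literature…QuadraticTwist`) — ROUTE-INDEPENDENT.  No instances, no notation.  Refuter verdict R-desc-35 pending at landing
time (audit points: `W.LFunction p = a_p` convention; `IsQuadTwistPair` at `j ∈ {0, 1728}`; optimality clauses load-bearing; global minimality).
NOT IN PRINT in this form (nearest: Delaunay 2003 Thm 1 for odd `q ∤ N`; Watkins 2002); BC5 = HOME/desc/g19/t16/ (T16-all.tsv 103 724/103 724;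
PAIRLAW 269 574 + 167 110 + 62 312 optimal pairs, 0 violations).  FALSIFIER: one optimal twist pair violating the identity (D-desc-33 extends the
range).  PARTITION 0 · beyond-print theorem: no · bears_on stmt-BirchSwinnertonDyer-22967 (C2; reads `deg φ`, not `c`) · BSD is not proved by
this; beyond Cremona's range the laws are `c_{E ⊗ χ} = c_E` in disguise (desc), which is OPEN at additive primes.

Rows E-desc-137 `TwistDescentExponentLaw` (local, DERIVABLE) and E-desc-136 `TwistDescentDegreeLawAtSixteen` (the LAW).
Nothing is asserted: both are `def … : Prop` tagged `@[conjecture]`.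

THE DICTIONARY.  A weight-2 newform `f` with `16 ∥ N` and trivial character has local type at 2 of conductor exponent 4; the
representations of `D₂^× / ℚ₂^×(1+𝔓³)` (a group of order 48 with the central involution `V = (1+𝔓²)/(1+𝔓³)(1+2ℤ₂)`) that are
non-trivial on `1+𝔓²` are exactly `ρ ⊗ (χ₋₄ ∘ Nrd)` for `ρ` a representation of `S₄ = D₂^×/ℚ₂^×(1+𝔓²)` (`χ₋₄ ∘ Nrd` is a
genuine linear character of order 2, so the group is `S₄ × C₂`), and the ramified principal series of exponent 4 are
`PS(μ, μ⁻¹) ⊗ χ₋₄`.  Hence EVERY local type of exponent 4 is the `χ₋₄`-twist of a type of exponent `a₀ ≤ 3`, and conversely;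
for exponent `≥ 5` the twist preserves the exponent.  For elliptic curves: `E ↦ E ⊗ χ₋₄ = E^{(−1)}` swaps `{f₂ ≤ 3}` and
`{f₂ = 4}` and fixes `f₂ ≥ 5` — 132 535 / 132 535 curves (every curve of conductor `< 2·10⁴`, HOME/desc/g19/t16/TWISTEXP.txt).
So the `16 ∥ N` stratum carries NO new quaternionic model: its Jacquet–Langlands vectors are those of the `2 ∥ N`, `4 ∥ N`,
`8 ∥ N` strata (Eichler, ε, ψ models) with eigenvalues multiplied by `χ₋₄(ℓ)`, and the principal-series part is invisible to
`B_{2,∞}`.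

THE LAW (E-desc-136; census HOME/desc/g19/t16/T16-all.tsv = ALL 103 724 optimal curves with `16 ∥ N < 2·10⁵`, Cremona's
ecdata degrees; `E₀` = the optimal curve in the isogeny class of `E^{(−1)}`, `μ = deg φ_{E^{(−1)}} / deg φ_{E₀}`):
  `deg φ(E) · μ = λ · deg φ(E₀)`,  `λ = 2, 4, 24, 8·(9 − a₂(E₀)²)` for `a₀ = f₂(E^{(−1)}) = 3, 2, 1, 0`
— 103 724 / 103 724 (with `E₀ = 990h3` in class 990h); `μ = 1` (the twist is itself optimal) in 103 664 of them, and in all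
52 010 supercuspidal cases `a₀ ∈ {2, 3}`.  Typed below in the generic form `μ = 1` (both curves optimal).  Consequence for the
cell question: `ord₂ deg φ(E) = ord₂ deg φ(E₀) + {1, 2, 3, 3 + v₂(9 − a₂²)}` — the controlling local invariants at a `16 ∥ N`
prime are the depth `a₀` of the `χ₋₄`-twisted type and, in the principal-series case, `a₂(E₀)`; no Tamagawa number enters.

PRINT STATUS.  For a twist by an ODD prime `q ∤ N` the Petersson-norm ratio `(q−1)(q+1−a_q)(q+1+a_q)/q · 2^{k−m}` is
[Delaunay 2003, Thm 1] (used in arXiv:2411.08321 p.10 and arXiv:2102.04185); with `deg φ = 4π²‖f‖²c²/vol` the law is the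
`q = 2`, `2 ∣ N` analogue ((9 − a₂²) = (q+1−a_q)(q+1+a_q), 3 = q² − 1, 1 for supercuspidal `π₀`) combined with `c_E = c_{E₀}`;
beyond Cremona's range it is therefore a Manin-constant statement in disguise (`c_{E ⊗ χ₋₄} = c_E`).  Not located in print in
this explicit form (searches in MEMO-desc §44).
-/

open scoped MatrixGroups ModularForm
open CongruenceSubgroup WeierstrassCurve Literature.NumberTheory.EllipticCurves.ModularForms

namespace Summit.BirchSwinnertonDyer.Rank1Residual.ManinAdditive.TwistDescent

/-- `W'` is (ℚ-isomorphic to) the quadratic twist of `W` by `−1`: `(c₄, c₆) ↦ (u⁴ c₄, −u⁶ c₆)` for some `u ∈ ℚ^×`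
(for `j = 1728`, i.e. `c₆ = 0`, this makes `W' ≅ W`, as it should). -/
def IsNegTwistPair (W W' : WeierstrassCurve ℚ) : Prop :=
  ∃ u : ℚ, u ≠ 0 ∧ W'.c₄ = u ^ 4 * W.c₄ ∧ W'.c₆ = -(u ^ 6 * W.c₆)

/-- `IsNegTwistPair` is symmetric (rescale by `u⁻¹`). -/
theorem isNegTwistPair_symm {W W' : WeierstrassCurve ℚ} (h : IsNegTwistPair W W') : IsNegTwistPair W' W := by
  obtain ⟨u, hu, h4, h6⟩ := h
  refine ⟨u⁻¹, inv_ne_zero hu, ?_, ?_⟩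
  · rw [h4]; field_simp
  · rw [h6]; field_simp

/-- E-desc-137 (local; IN PRINT as the `(f, f^d)` columns of [Barrios–Roy–Sahajpal–Tallana–Tobin–Wiersema 2025, Thm 5.1] and partly
in the tree: `Literature.NumberTheory.EllipticCurves.BarriosEtAl2025.conductorExponent_quadraticTwist_two_of_le_one`,
`Summit.BirchSwinnertonDyer.BirchSwinnertonDyer.Theorems.ManinLocalTwoThree.conductorExponent_eq_of_conductorExponent_dyadicTwist_le_one`;
kept here as the typed dictionary row; census: every curve of conductor `< 2·10⁴`, 132 535 / 132 535).  `χ₋₄`-twisting swaps conductor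
exponent 4 at 2 with exponent `≤ 3` and preserves exponents `≥ 5` (group-theoretically: `D₂^×/ℚ₂^×(1+𝔓³) ≅ S₄ × C₂`).
Typed dictionary row (plain `def`, nothing asserted; typer: not tagged `@[conjecture]` because it is in print).
[cite: BarriosEtAl2025, Thm 5.1 (arXiv:2501.03209 pp. 15–16)] -/
def TwistDescentExponentLaw : Prop :=
  ∀ (W W' : WeierstrassCurve ℚ) [W.IsElliptic] [W'.IsElliptic], IsNegTwistPair W W' →
    (padicValNat 2 (W.conductorNorm ℤ) = 4 ↔ padicValNat 2 (W'.conductorNorm ℤ) ≤ 3) ∧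
    (5 ≤ padicValNat 2 (W.conductorNorm ℤ) → padicValNat 2 (W'.conductorNorm ℤ) = padicValNat 2 (W.conductorNorm ℤ))

/-- the twist factor `λ(E₀)`: `2, 4, 24, 8(9 − a₂²)` according to the conductor exponent `3, 2, 1, 0` of `E₀` at 2
(`a₂ = W'.LFunction 2`, the Hecke eigenvalue of the good-reduction curve). -/
noncomputable def twistFactor (W' : WeierstrassCurve ℚ) [W'.IsElliptic] : ℤ :=
  if padicValNat 2 (W'.conductorNorm ℤ) = 3 then 2
  else if padicValNat 2 (W'.conductorNorm ℤ) = 2 then 4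
  else if padicValNat 2 (W'.conductorNorm ℤ) = 1 then 24
  else 8 * (9 - (W'.LFunction 2) ^ 2)

/-- E-desc-136, the TWIST-DESCENT DEGREE LAW at `16 ∥ N` (generic form: both curves optimal).  `W` optimal of conductor `16·M`,
`M` odd; `W'` its `−1`-twist, also optimal (minimal degree among parametrisations by the same newform, lattice clause);
then `deg φ(W) = λ(W') · deg φ(W')`.  Census: 103 664 / 103 664 optimal curves `16 ∥ N < 2·10⁵` whose twist is optimal
(T16-all.tsv; the other 60 obey `deg φ(W)·μ = λ·deg φ(E₀)`).  Why it might fail: beyond Cremona's range the law is equivalent,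
given the Petersson-norm ratio of the twist, to `c_W = c_{W'}` (Manin constants), which is open at additive level 16.
(arXiv:2411.08321 §4 p. 10 uses it for `m_{E^{(d)}}/m_E`.)
[cite: Delaunay2003, Thm 1 (Petersson norm of prime twists, `q` odd, `q ∤ N`)] -/
@[conjecture]
def TwistDescentDegreeLawAtSixteen : Prop :=
  ∀ (M : ℕ), Odd M →
  ∀ (W W' : WeierstrassCurve ℚ) [W.IsElliptic] [W'.IsElliptic] [NeZero (W.conductorNorm ℤ)] [NeZero (W'.conductorNorm ℤ)]
    (D : ModularParametrizationData W (W.conductorNorm ℤ)) (D' : ModularParametrizationData W' (W'.conductorNorm ℤ)),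
    IsNegTwistPair W W' → W.conductorNorm ℤ = 16 * M →
    (∀ z ∈ D.L.lattice, ∃ w ∈ periodLattice D.f, z = D.c * w) →
    (∀ (V : WeierstrassCurve ℚ) [V.IsElliptic] (DV : ModularParametrizationData V (W.conductorNorm ℤ)),
        DV.f = D.f → D.modularDegree ≤ DV.modularDegree) →
    (∀ z ∈ D'.L.lattice, ∃ w ∈ periodLattice D'.f, z = D'.c * w) →
    (∀ (V : WeierstrassCurve ℚ) [V.IsElliptic] (DV : ModularParametrizationData V (W'.conductorNorm ℤ)),
        DV.f = D'.f → D'.modularDegree ≤ DV.modularDegree) →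
    (D.modularDegree : ℤ) = twistFactor W' * D'.modularDegree

/-- sanity: the four values of the twist factor are positive except possibly the principal-series one, which is positive by
the Hasse bound `|a₂| ≤ 2` (here only the arithmetic of the branch values). -/
theorem twistFactor_ps_pos (a : ℤ) (ha : a ^ 2 ≤ 8) : 0 < 8 * (9 - a ^ 2) := by omega

/-! ## §3. The master law: `K(E) = deg φ(E) · L₂(Sym² E, 2)⁻¹_naive / (2^{a(E)} · 2^{v₂(Δ_E)/6})` is a quadratic-twist invariant at 2

E-desc-138.  Found after E-desc-136 by running ALL pairs `(E, E^{(d)})`, `d ∈ {−1, 2, −2}`, both optimal: the single identity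
`deg φ(E) · c(E) · 2^{a(E')} · 2^{k} = deg φ(E') · c(E') · 2^{a(E)}`, `6k = v₂Δ_min(E') − v₂Δ_min(E)`,
`c = (3 − a₂)(3 + a₂)/8` (good), `3/4` (multiplicative), `1` (additive) = the inverse naive Euler factor of `Sym² E` at `s = 2`,
holds for every optimal twist pair in range (all exponent pairs `(a, a')` that occur: `(≤3, 4)`, `(≤5, 6)`, `(4, 6)`, `(5, 5)`, …).
E-desc-136 is its `(4, ≤ 3)` case (`k = 2` for `a' ≤ 1`, `k = 0` for `a' ∈ {2, 3}`).  In Watkins' formula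
`deg φ = N · L(Sym² E, 2) / (2 π² Ω c²) · ∏ U_p` this says: the 2-adic fudge factor, the Manin constant and `Ω·|Δ|^{1/6}` are
jointly twist-invariant — beyond the tables its content is `c_E = c_{E ⊗ χ}` for `χ ∈ {χ₋₄, χ₈, χ₋₈}`. -/

/-- `W'` is (ℚ-isomorphic to) the quadratic twist of `W` by `d`: `(c₄, c₆) ↦ (u⁴ d² c₄, u⁶ d³ c₆)`, `u ∈ ℚ^×`. -/
def IsQuadTwistPair (d : ℚ) (W W' : WeierstrassCurve ℚ) : Prop :=
  ∃ u : ℚ, u ≠ 0 ∧ W'.c₄ = u ^ 4 * d ^ 2 * W.c₄ ∧ W'.c₆ = u ^ 6 * d ^ 3 * W.c₆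

/-- the `−1`-twist pair predicate is the `d = −1` case of `IsQuadTwistPair`. -/
theorem isNegTwistPair_iff_isQuadTwistPair (W W' : WeierstrassCurve ℚ) :
    IsNegTwistPair W W' ↔ IsQuadTwistPair (-1) W W' := by
  simp only [IsNegTwistPair, IsQuadTwistPair]
  refine exists_congr fun u => ?_
  constructor
  · rintro ⟨hu, h4, h6⟩; exact ⟨hu, by rw [h4]; ring, by rw [h6]; ring⟩
  · rintro ⟨hu, h4, h6⟩; exact ⟨hu, by rw [h4]; ring, by rw [h6]; ring⟩

/-- dictionary with the tree's `WeierstrassCurve.quadraticTwist` (`quadraticTwist_c₄/c₆`): `W'` is a `u`-rescaling of `W.quadraticTwist d`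
at the level of `(c₄, c₆)`. -/
theorem isQuadTwistPair_iff_quadraticTwist (d : ℚ) (W W' : WeierstrassCurve ℚ) :
    IsQuadTwistPair d W W' ↔
      ∃ u : ℚ, u ≠ 0 ∧ W'.c₄ = u ^ 4 * (W.quadraticTwist d).c₄ ∧ W'.c₆ = u ^ 6 * (W.quadraticTwist d).c₆ := by
  simp only [IsQuadTwistPair, quadraticTwist_c₄, quadraticTwist_c₆, mul_assoc]

/-- `IsQuadTwistPair d` is symmetric for `d ≠ 0` (rescale by `(u d)⁻¹`). -/
theorem isQuadTwistPair_symm {d : ℚ} (hd : d ≠ 0) {W W' : WeierstrassCurve ℚ} (h : IsQuadTwistPair d W W') :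
    IsQuadTwistPair d W' W := by
  obtain ⟨u, hu, h4, h6⟩ := h
  refine ⟨(u * d)⁻¹, inv_ne_zero (mul_ne_zero hu hd), ?_, ?_⟩
  · rw [h4]; field_simp
  · rw [h6]; field_simp

/-- The inverse NAIVE local Euler factor of `Sym² E` at `p = 2`, `s = 2`, read off the conductor exponent and `a₂ = W.LFunction 2`:
good reduction `(1 − α²/4)(1 − 1/2)(1 − β²/4) = (3 − a₂)(3 + a₂)/8`; multiplicative `1 − 2^{−2} = 3/4`; additive `1`. -/
noncomputable def symSqFactorAtTwo (W : WeierstrassCurve ℚ) [W.IsElliptic] : ℚ :=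
  if padicValNat 2 (W.conductorNorm ℤ) = 0 then (((3 - W.LFunction 2) * (3 + W.LFunction 2) : ℤ) : ℚ) / 8
  else if padicValNat 2 (W.conductorNorm ℤ) = 1 then 3 / 4 else 1

/-- E-desc-138, the QUADRATIC-TWIST DEGREE INVARIANCE at 2 (master law; E-desc-136 = its `16 ∥ N` case).  For OPTIMAL `W`, `W'`
(minimal-degree + lattice clauses, globally minimal models) that are `d`-twists of each other, `d ∈ {−1, 2, −2}` (the characters
`χ₋₄, χ₈, χ₋₈`, unramified outside 2): `v₂Δ_{W'} − v₂Δ_W = 6k` and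
`deg φ(W) · c(W) · 2^{a(W')} · 2^{k} = deg φ(W') · c(W') · 2^{a(W)}`, `c = symSqFactorAtTwo`, `a = v₂(conductor)`.
Census (BC5): PAIRLAW tables (HOME/desc/g19/t16/PL-*.err): every optimal pair with `N(W) < 5·10⁴`, `N(W') < 2·10⁵` — see §44.6
of MEMO-desc for the counts by `(a, a')`: 269 574 / 269 574, 0 violations; violations occur only for NON-optimal partners (153 of 11 692) (as they must: the degree
to a non-optimal curve carries the isogeny degree).  Why it might fail: beyond the tables it is equivalent (Watkins' formula) to the
twist-invariance of the Manin constant, `c_W = c_{W ⊗ χ}`, open for additive reduction at 2.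
(Also arXiv:2411.08321 p. 10.) [cite: Watkins2002, §2–3 (deg φ via L(Sym² E, 2) and local fudge factors)] [cite: Delaunay2003, Thm 1] -/
@[conjecture]
def QuadTwistDegreeInvariance : Prop :=
  ∀ (d : ℚ), (d = -1 ∨ d = 2 ∨ d = -2) →
  ∀ (W W' : WeierstrassCurve ℚ) [W.IsElliptic] [W'.IsElliptic] [W.IsGloballyMinimal] [W'.IsGloballyMinimal]
    [NeZero (W.conductorNorm ℤ)] [NeZero (W'.conductorNorm ℤ)]
    (D : ModularParametrizationData W (W.conductorNorm ℤ)) (D' : ModularParametrizationData W' (W'.conductorNorm ℤ)),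
    IsQuadTwistPair d W W' →
    (∀ z ∈ D.L.lattice, ∃ w ∈ periodLattice D.f, z = D.c * w) →
    (∀ (V : WeierstrassCurve ℚ) [V.IsElliptic] (DV : ModularParametrizationData V (W.conductorNorm ℤ)),
        DV.f = D.f → D.modularDegree ≤ DV.modularDegree) →
    (∀ z ∈ D'.L.lattice, ∃ w ∈ periodLattice D'.f, z = D'.c * w) →
    (∀ (V : WeierstrassCurve ℚ) [V.IsElliptic] (DV : ModularParametrizationData V (W'.conductorNorm ℤ)),
        DV.f = D'.f → D'.modularDegree ≤ DV.modularDegree) →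
    ∃ k : ℤ, padicValRat 2 W'.Δ - padicValRat 2 W.Δ = 6 * k ∧
      (D.modularDegree : ℚ) * symSqFactorAtTwo W * 2 ^ padicValNat 2 (W'.conductorNorm ℤ) * (2 : ℚ) ^ k
        = (D'.modularDegree : ℚ) * symSqFactorAtTwo W' * 2 ^ padicValNat 2 (W.conductorNorm ℤ)

/-- consistency of E-desc-138 with E-desc-136 on the branch values: `2^{4 − a'} · 2^{k(a')} · c(a') = twistFactor`, with
`k = 2` for `a' ≤ 1` and `k = 0` for `a' ∈ {2, 3}` (pure arithmetic of the four branches; `t = a₂`). -/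
theorem twistFactor_branches (t : ℤ) :
    ((2 : ℚ) ^ (4 - 3 : ℕ) * 2 ^ (0 : ℤ) * 1 = 2) ∧ ((2 : ℚ) ^ (4 - 2 : ℕ) * 2 ^ (0 : ℤ) * 1 = 4) ∧
    ((2 : ℚ) ^ (4 - 1 : ℕ) * 2 ^ (2 : ℤ) * (3 / 4) = 24) ∧
    ((2 : ℚ) ^ (4 - 0 : ℕ) * 2 ^ (2 : ℤ) * ((((3 - t) * (3 + t) : ℤ) : ℚ) / 8) = ((8 * (9 - t ^ 2) : ℤ) : ℚ)) := by
  refine ⟨by norm_num, by norm_num, by norm_num, ?_⟩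
  push_cast; ring

/-! ## §4. The same law at every prime (E-desc-139): `K_p(E) = deg φ(E) · c_p(E) / (p^{a_p(E)} · p^{v_p(Δ_E)/6})`

For a prime `p` and the quadratic character ramified only at `p` (`d = p* = ±p ≡ 1 (4)` for odd `p`; `d ∈ {−1, 2, −2}` for
`p = 2`), the identity `deg φ(W) · c_p(W) · p^{a_p(W')} · p^{k} = deg φ(W') · c_p(W') · p^{a_p(W)}`, `6k = v_pΔ_{W'} − v_pΔ_W`,
`c_p = (p−1)(p+1−a_p)(p+1+a_p)/p³ | (p²−1)/p² | 1` (good | multiplicative | additive = inverse naive Euler factor of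
`L(Sym² E, s)` at `s = 2`), holds for every optimal twist pair in range: `p = 2`: 269 574 / 269 574 pairs (`N(W) < 5·10⁴`,
`N(W') < 2·10⁵`, all `(a, a') ∈ {(≤3,4), (≤5,6), (4,6), (5,5), (6,6), (7,7), (8,8)}`); `p = 3` (`d = −3`, `N(W) < 5·10⁴`, incl.
`27 ∥ N` 12 410, `81` 3 012, `243` 1 250 pairs): 167 110 / 167 110; `p = 5, 7, 11` (`N(W) < 10⁴`): 32 806 + 19 939 + 9 567, 0 violations
(MEMO-desc §44.7; HOME/desc/g19/t16/PAIRLAW-SUMMARY.md); the good-reduction rows are [Delaunay 2003, Thm 1].  The additive rows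
(`p² ∣ N`) are the content for this cell: under twisting, NO local invariant beyond `(a_p, v_pΔ mod 6·ℤ-shift, a_p-eigenvalue class)`
enters `deg φ`, at `p = 2` and `p = 3` alike. -/

/-- inverse naive Euler factor of `Sym² E` at `p`, `s = 2`: `(p−1)(p+1−a_p)(p+1+a_p)/p³` (good), `(p²−1)/p²` (multiplicative),
`1` (additive); `a_p = W.LFunction p`. -/
noncomputable def symSqFactorAt (p : ℕ) (W : WeierstrassCurve ℚ) [W.IsElliptic] : ℚ :=
  if padicValNat p (W.conductorNorm ℤ) = 0 then
    ((((p : ℤ) - 1) * ((p : ℤ) + 1 - W.LFunction p) * ((p : ℤ) + 1 + W.LFunction p) : ℤ) : ℚ) / ((p : ℚ) ^ 3)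
  else if padicValNat p (W.conductorNorm ℤ) = 1 then (((p : ℚ) ^ 2 - 1)) / ((p : ℚ) ^ 2) else 1

/-- at `p = 2` the general naive `Sym²` factor is `symSqFactorAtTwo`. -/
theorem symSqFactorAt_two (W : WeierstrassCurve ℚ) [W.IsElliptic] : symSqFactorAt 2 W = symSqFactorAtTwo W := by
  unfold symSqFactorAt symSqFactorAtTwo
  split_ifs <;> push_cast <;> ring

/-- the twisting parameter whose character is ramified exactly at `p`: `p* = ±p ≡ 1 (mod 4)` for odd `p`. -/
def primeStar (p : ℕ) : ℤ := if p % 4 = 1 then (p : ℤ) else -(p : ℤ)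

/-- admissible `(p, d)`: `χ_d` is a quadratic character ramified only at `p`. -/
def IsAdmissibleTwist (p : ℕ) (d : ℚ) : Prop :=
  (p = 2 ∧ (d = -1 ∨ d = 2 ∨ d = -2)) ∨ (p ≠ 2 ∧ d = (primeStar p : ℚ))

/-- E-desc-139, QUADRATIC-TWIST DEGREE INVARIANCE AT `p` (all primes; E-desc-138 is `p = 2`).  Both curves optimal (minimal
degree for their newform + lattice clause), globally minimal models, `W' ≅ W ⊗ χ_d` with `χ_d` ramified only at `p`. -/
@[conjecture]
def QuadTwistDegreeInvarianceAt (p : ℕ) : Prop :=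
  p.Prime →
  ∀ (d : ℚ), IsAdmissibleTwist p d →
  ∀ (W W' : WeierstrassCurve ℚ) [W.IsElliptic] [W'.IsElliptic] [W.IsGloballyMinimal] [W'.IsGloballyMinimal]
    [NeZero (W.conductorNorm ℤ)] [NeZero (W'.conductorNorm ℤ)]
    (D : ModularParametrizationData W (W.conductorNorm ℤ)) (D' : ModularParametrizationData W' (W'.conductorNorm ℤ)),
    IsQuadTwistPair d W W' →
    (∀ z ∈ D.L.lattice, ∃ w ∈ periodLattice D.f, z = D.c * w) →
    (∀ (V : WeierstrassCurve ℚ) [V.IsElliptic] (DV : ModularParametrizationData V (W.conductorNorm ℤ)),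
        DV.f = D.f → D.modularDegree ≤ DV.modularDegree) →
    (∀ z ∈ D'.L.lattice, ∃ w ∈ periodLattice D'.f, z = D'.c * w) →
    (∀ (V : WeierstrassCurve ℚ) [V.IsElliptic] (DV : ModularParametrizationData V (W'.conductorNorm ℤ)),
        DV.f = D'.f → D'.modularDegree ≤ DV.modularDegree) →
    ∃ k : ℤ, padicValRat p W'.Δ - padicValRat p W.Δ = 6 * k ∧
      (D.modularDegree : ℚ) * symSqFactorAt p W * (p : ℚ) ^ padicValNat p (W'.conductorNorm ℤ) * (p : ℚ) ^ k
        = (D'.modularDegree : ℚ) * symSqFactorAt p W' * (p : ℚ) ^ padicValNat p (W.conductorNorm ℤ)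

/-- the family over all primes (census: `p = 2, 3` in the additive regime; `p = 5, 7, 11` good/multiplicative/additive `a = 2`; 498 996 optimal pairs in all). -/
@[conjecture]
def QuadTwistDegreeInvarianceAllPrimes : Prop := ∀ p : ℕ, QuadTwistDegreeInvarianceAt p

/-- the all-primes family specialises to each prime. -/
theorem quadTwistDegreeInvarianceAt_of_all (h : QuadTwistDegreeInvarianceAllPrimes) (p : ℕ) :
    QuadTwistDegreeInvarianceAt p := h p

/-- Delaunay's shape on the good-reduction branch: for `p ∤ N`, `a' = 2`, `k = 1` the law reads
`deg φ(W') = (p−1)(p+1−a_p)(p+1+a_p) · deg φ(W)` (pure arithmetic of the branch: `c·p²·p / 1 = (p−1)(p+1−a)(p+1+a)`). -/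
theorem good_branch_factor (p : ℕ) (hp : 0 < p) (t : ℤ) :
    ((((p : ℤ) - 1) * ((p : ℤ) + 1 - t) * ((p : ℤ) + 1 + t) : ℤ) : ℚ) / ((p : ℚ) ^ 3) * (p : ℚ) ^ (2 : ℕ) * (p : ℚ) ^ (1 : ℤ)
      = ((((p : ℤ) - 1) * ((p : ℤ) + 1 - t) * ((p : ℤ) + 1 + t) : ℤ) : ℚ) := by
  have hp' : (p : ℚ) ≠ 0 := by exact_mod_cast hp.ne'
  field_simp

end Summit.BirchSwinnertonDyer.Rank1Residual.ManinAdditive.TwistDescent
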